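import Mathlib.MeasureTheory.Integral.Bochner.Basic
import Mathlib.MeasureTheory.Integral.Bochner.Set
import Literature.Analysis.FluidPDE.NewtonKernel
import HarnessLib

/-!
# The smooth cutoff of a ball, with the scale-invariant gradient bound

Analysis/FluidPDE support file: the cutoffs `ψᵢ` of Tao's Whitney balls (T. Tao, arXiv:1108.1165,
§10, proof of Thm. 10.1, p. 32: "Let `ψᵢ` be a smooth cutoff to the ball `3Bᵢ := B(xᵢ,3rᵢ)` that
equals `1` on `2Bᵢ := B(xᵢ,2rᵢ)`"), used both in the local Biot–Savart law (`LocalBiotSavart`) and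
in the local Sobolev inequality on balls (`LocalSobolevBall`: "`‖ω‖_{L⁶(Bᵢ)} ≲ ‖ωψᵢ‖_{L⁶(ℝ³)} ≲
‖∇(ωψᵢ)‖_{L²(ℝ³)} ≲ ‖∇ω‖_{L²(3Bᵢ)} + rᵢ⁻¹‖ω‖_{L²(3Bᵢ)}`"). We set
`ballCutoff c r = radialCutoff (2r) (3r) (· - c)` (the tree's radial smooth cutoff,
`FluidPDE/NewtonKernel`): smooth, `= 1` on `B̄(c, 2r)`, `= 0` off `B(c, 3r)`, values in `[0,1]`,
compact support, and — by the scaling `θ_{2r,3r}(z) = θ_{2,3}(z/r)` — the gradient bound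
`‖D(ballCutoff c r)(y)‖ ≤ C₀/r` with an absolute `C₀` (`exists_norm_fderiv_ballCutoff_le`), the
source of the factor `rᵢ⁻¹` in Tao's display.

## References

* T. Tao, arXiv:1108.1165 (`Tao2011`), §10, proof of Thm. 10.1 (p. 32).
-/

noncomputable section

open MeasureTheory Set Filter Topology Function Metric

namespace Literature.Analysis.FluidPDE

/-- Local notation for physical space `ℝ³ = EuclideanSpace ℝ (Fin 3)`. -/
local notation "ℝ³" => EuclideanSpace ℝ (Fin 3)

section Cutoff

variable {c : ℝ³} {r : ℝ}

/-- The smooth cutoff of the ball `B(c, 3r)`: `ψ = 1` on `B̄(c, 2r)`, `ψ = 0` off `B(c, 3r)`,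
`0 ≤ ψ ≤ 1` (Tao's `ψᵢ`, "a smooth cutoff to the ball `3Bᵢ` that equals `1` on `2Bᵢ`"). [cite: Tao2011, §10, proof of Thm. 10.1 (p. 32)] -/
def ballCutoff (c : ℝ³) (r : ℝ) (y : ℝ³) : ℝ := radialCutoff (2 * r) (3 * r) (y - c)

/-- Unfolding `ballCutoff`. [folklore] -/
theorem ballCutoff_apply (c : ℝ³) (r : ℝ) (y : ℝ³) :
    ballCutoff c r y = radialCutoff (2 * r) (3 * r) (y - c) := rfl

/-- `ψ` is smooth. [folklore] -/
theorem contDiff_ballCutoff (c : ℝ³) (r : ℝ) {n : ℕ∞} : ContDiff ℝ n (ballCutoff c r) :=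
  (radialCutoff_contDiff (2 * r) (3 * r)).comp (contDiff_id.sub contDiff_const)

/-- `ψ = 1` on `B̄(c, 2r)`. [folklore] -/
theorem ballCutoff_eq_one (hr : 0 < r) {y : ℝ³} (hy : ‖y - c‖ ≤ 2 * r) : ballCutoff c r y = 1 :=
  radialCutoff_eq_one (by positivity) (by linarith) hy

/-- `ψ = 0` off `B(c, 3r)`. [folklore] -/
theorem ballCutoff_eq_zero (hr : 0 < r) {y : ℝ³} (hy : 3 * r ≤ ‖y - c‖) : ballCutoff c r y = 0 :=
  radialCutoff_eq_zero (by positivity) (by linarith) hy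

/-- `0 ≤ ψ`. [folklore] -/
theorem ballCutoff_nonneg (c : ℝ³) (r : ℝ) (y : ℝ³) : 0 ≤ ballCutoff c r y :=
  radialCutoff_nonneg _ _ _

/-- `ψ ≤ 1`. [folklore] -/
theorem ballCutoff_le_one (c : ℝ³) (r : ℝ) (y : ℝ³) : ballCutoff c r y ≤ 1 :=
  radialCutoff_le_one _ _ _

/-- `|ψ| ≤ 1`. [folklore] -/
theorem abs_ballCutoff_le_one (c : ℝ³) (r : ℝ) (y : ℝ³) : |ballCutoff c r y| ≤ 1 := by
  rw [abs_of_nonneg (ballCutoff_nonneg c r y)]; exact ballCutoff_le_one c r y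

/-- `ψ` has compact support (in `B̄(c, 3r)`). [folklore] -/
theorem hasCompactSupport_ballCutoff (hr : 0 < r) : HasCompactSupport (ballCutoff c r) := by
  refine HasCompactSupport.intro (isCompact_closedBall c (3 * r)) fun y hy => ?_
  rw [mem_closedBall, dist_eq_norm, not_le] at hy
  exact ballCutoff_eq_zero hr hy.le

/-- `ψ = 1` near every point of the open ball `B(c, 2r)`. [folklore] -/
theorem ballCutoff_eventuallyEq_one (hr : 0 < r) {y : ℝ³} (hy : y ∈ ball c (2 * r)) :
    ballCutoff c r =ᶠ[𝓝 y] fun _ => 1 :=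
  eventually_of_mem (isOpen_ball.mem_nhds hy) fun z hz => by
    rw [mem_ball, dist_eq_norm] at hz
    exact ballCutoff_eq_one hr hz.le

/-- `ψ = 0` near every point off the closed ball `B̄(c, 3r)`. [folklore] -/
theorem ballCutoff_eventuallyEq_zero (hr : 0 < r) {y : ℝ³} (hy : y ∉ closedBall c (3 * r)) :
    ballCutoff c r =ᶠ[𝓝 y] fun _ => 0 :=
  eventually_of_mem (isClosed_closedBall.isOpen_compl.mem_nhds hy) fun z hz => by
    rw [mem_compl_iff, mem_closedBall, dist_eq_norm, not_le] at hz
    exact ballCutoff_eq_zero hr hz.le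

/-- Multiplication by `ψ` does not change a function near a point of `B(c, 2r)`. [folklore] -/
theorem ballCutoff_mul_eventuallyEq (hr : 0 < r) (f : ℝ³ → ℝ) {y : ℝ³} (hy : y ∈ ball c (2 * r)) :
    (fun z => ballCutoff c r z * f z) =ᶠ[𝓝 y] f :=
  (ballCutoff_eventuallyEq_one hr hy).mono fun z hz => by
    show ballCutoff c r z * f z = f z
    rw [hz, one_mul]

/-- A product with `ψ` vanishes off `B(c, 3r)`. [folklore] -/
theorem ballCutoff_mul_eq_zero (hr : 0 < r) (f : ℝ³ → ℝ) {y : ℝ³} (hy : y ∉ ball c (3 * r)) :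
    ballCutoff c r y * f y = 0 := by
  rw [mem_ball, dist_eq_norm, not_lt] at hy
  rw [ballCutoff_eq_zero hr hy, zero_mul]

/-- `∫ (ψ f)² ≤ ∫_{B(c,3r)} f²` for continuous `f`. [folklore] -/
theorem integral_sq_ballCutoff_mul_le (hr : 0 < r) {f : ℝ³ → ℝ} (hf : Continuous f) :
    ∫ y, (ballCutoff c r y * f y) ^ 2 ≤ ∫ y in ball c (3 * r), f y ^ 2 := by
  have hfi : IntegrableOn (fun y => f y ^ 2) (ball c (3 * r)) :=
    ((hf.pow 2).continuousOn.integrableOn_compact (isCompact_closedBall c (3 * r))).mono_set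
      ball_subset_closedBall
  rw [← setIntegral_eq_integral_of_forall_compl_eq_zero (s := ball c (3 * r))
    (fun y hy => by simp [ballCutoff_mul_eq_zero hr f hy])]
  refine setIntegral_mono_on ?_ hfi measurableSet_ball fun y _ => ?_
  · exact (((contDiff_ballCutoff c r (n := 0)).continuous.mul hf).pow 2).continuousOn.integrableOn_compact
      (isCompact_closedBall c (3 * r)) |>.mono_set ball_subset_closedBall
  · rw [mul_pow]
    have h1 : ballCutoff c r y ^ 2 ≤ 1 := by
      have := ballCutoff_nonneg c r y; have := ballCutoff_le_one c r y; nlinarith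
    nlinarith [sq_nonneg (f y)]

/-- **Scaling**: `ballCutoff c r y = θ_{2,3}(r⁻¹(y - c))`. [folklore] -/
theorem ballCutoff_eq_scale (hr : 0 < r) (y : ℝ³) :
    ballCutoff c r y = radialCutoff 2 3 (r⁻¹ • (y - c)) := by
  rw [ballCutoff_apply, show 2 * r = r * 2 by ring, show 3 * r = r * 3 by ring, radialCutoff_scale hr]

/-- **The scale-invariant gradient bound**: there is an absolute `C₀ ≥ 0` with
`‖D(ballCutoff c r)(y)‖ ≤ C₀ / r` for all `c`, `r > 0`, `y`. [folklore] -/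
theorem exists_norm_fderiv_ballCutoff_le :
    ∃ C₀ : ℝ, 0 ≤ C₀ ∧ ∀ (c : ℝ³) (r : ℝ), 0 < r → ∀ y : ℝ³, ‖fderiv ℝ (ballCutoff c r) y‖ ≤ C₀ / r := by
  set θ : ℝ³ → ℝ := radialCutoff 2 3 with hθ
  have hθs : ContDiff ℝ 1 θ := radialCutoff_contDiff 2 3
  have hθc : HasCompactSupport θ := hasCompactSupport_radialCutoff (by norm_num) (by norm_num)
  obtain ⟨C, hC⟩ := (hθs.continuous_fderiv one_ne_zero).bounded_above_of_compact_support
    (hθc.fderiv (𝕜 := ℝ))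
  refine ⟨max C 0, le_max_right _ _, fun c r hr y => ?_⟩
  have hfun : ballCutoff c r = fun y => θ (r⁻¹ • (y - c)) := funext fun y => ballCutoff_eq_scale hr y
  have hinner : HasFDerivAt (fun y : ℝ³ => r⁻¹ • (y - c)) (r⁻¹ • ContinuousLinearMap.id ℝ ℝ³) y := by
    exact ((hasFDerivAt_id (𝕜 := ℝ) y).sub_const c).const_smul r⁻¹
  have hcomp : HasFDerivAt (ballCutoff c r)
      ((fderiv ℝ θ (r⁻¹ • (y - c))).comp (r⁻¹ • ContinuousLinearMap.id ℝ ℝ³)) y := by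
    rw [hfun]
    exact ((hθs.differentiable one_ne_zero) _).hasFDerivAt.comp y hinner
  rw [hcomp.fderiv]
  calc ‖(fderiv ℝ θ (r⁻¹ • (y - c))).comp (r⁻¹ • ContinuousLinearMap.id ℝ ℝ³)‖
      ≤ ‖fderiv ℝ θ (r⁻¹ • (y - c))‖ * ‖r⁻¹ • ContinuousLinearMap.id ℝ ℝ³‖ :=
        ContinuousLinearMap.opNorm_comp_le _ _
    _ ≤ max C 0 * r⁻¹ := by
        refine mul_le_mul ((hC _).trans (le_max_left _ _)) ?_ (norm_nonneg _) (le_max_right _ _)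
        rw [norm_smul, norm_inv, Real.norm_of_nonneg hr.le]
        exact mul_le_of_le_one_right (inv_nonneg.2 hr.le) ContinuousLinearMap.norm_id_le
    _ = max C 0 / r := by rw [div_eq_mul_inv]

end Cutoff

end Literature.Analysis.FluidPDE

end
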